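import Summits.NavierStokesRegularity.FunctionalMining.RateBudgets
import Literature.Analysis.FluidPDE.NSGalerkinFourier
import Literature.Analysis.FluidPDE.SteadyGalerkinApprox
import Literature.Analysis.FunctionSpaces.TorusFourierModes
import HarnessLib

/-!
# Functional mining: the enstrophy is not monotone along Navier–Stokes on `T³` — the three-wave witness

Search for candidate a priori estimates; no regularity claim.

Cell `pub-nsfunc` (host summit NavierStokesRegularity, topic `FunctionalMining`), NO-GO branch.
`RateBudgets.lean` reduced the census row "the enstrophy `ℰ = ½‖∇u‖₂²` is non-increasing along
every zero-mean classical solution of unforced Navier–Stokes on `T³`"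
(`IsRateBudget torusEnstrophy 0`) to the vanishing of the enstrophy production
`∫⟪(v·∇)v, Δv⟫` at every smooth divergence-free zero-mean field
(`not_isRateBudget_torusEnstrophy_zero_of_witness`, via local existence, the `H¹` balance at the
initial time, `ν → 0⁺` and the parity `u ↦ −u`). This file supplies the WITNESS and closes the
row: the continuum twin, on the UNIT torus `(ℝ/ℤ)³`, of the Galerkin three-wave field of
`Literature/Analysis/FluidPDE/FluidComputer/EnstrophyProduction` (`ThreeWaves.tw`, `T_Z = 2`),

  `w(x) = (2 cos 2πx₂, 0, 2 cos 2πx₁ + 2 sin 2π(x₁ + x₂))`,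

written as the real vector trigonometric polynomial `realTrigPoly S ĉ` with support
`S = {±e₁, ±e₂, ±(e₁+e₂)}` and coefficients `ĉ(±e₁) = (0,0,1)`, `ĉ(±e₂) = (1,0,0)`,
`ĉ(±(e₁+e₂)) = (0,0,∓i)` (tree vocabulary `FunctionSpaces/TorusTrigPoly`,
`FluidPDE/NSGalerkinFourier`):

* `ThreeWaveTorus.isSmooth_w`, `.isDivFree_w` (transversal coefficients), `.hasZeroMean_w`
  (`0 ∉ S`), `.isConjSymm_c` (reality);
* `ThreeWaveTorus.production_eq_sum` — Parseval against `Δw` and the Fourier coefficients of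
  `(w·∇)w` (`integral_inner_realTrigPoly_right`, `mFourierCoeff_convect_realTrigPoly`):
  `∫⟪(w·∇)w, Δw⟫ = ∑_{k∈S} Re⟪N̂(k), −4π²|k|² ĉ(k)⟫_ℂ`, `N̂ = convectionCoeff S ĉ ĉ`;
* `ThreeWaveTorus.convectionCoeff_e1` … `_neg_e12` — the six convection coefficients
  (`N̂(±e₁) = (0,0,2π)`, `N̂(±e₂) = 0`, `N̂(±(e₁+e₂)) = (0,0,±2πi)`), by unrolling the 36-term sums;
* `ThreeWaveTorus.production_w` — **`∫⟪(w·∇)w, Δw⟫ = 16π³`** (`= (2π)³ · 2`, the Galerkin value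
  in unit-torus units; hand check in the cell's DERIVATIVES §4);
* `not_isRateBudget_torusEnstrophy_zero` — **the enstrophy is NOT non-increasing along every
  zero-mean classical solution of unforced Navier–Stokes on the unit 3-torus**: the first
  kernel-checked entry of the cell's NO-GO ledger (functional `ℰ`, class "monotone", witness `w`),
  the dynamic instance of the parity sieve. Everyone knows this; the point is that the whole chain
  census-row ↦ reduction ↦ explicit witness ↦ `¬` is now mechanical for the next candidates.

Deliberately NOT here: other candidates; the quadratic budget `EnstrophyQuadraticBudget C`
(needs a concentrating family, not a fixed trigonometric polynomial: Sieve 1).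
-/

noncomputable section

open MeasureTheory Complex
open scoped RealInnerProductSpace

namespace Summit.NavierStokesRegularity.FunctionalMining

open Literature.Analysis Literature.Analysis.FunctionSpaces Literature.Analysis.FunctionSpaces.Torus
  Literature.Analysis.FluidPDE

namespace ThreeWaveTorus

/-- `e₁ = (1,0,0)`. [folklore] -/
def e1 : Fin 3 → ℤ := ![1, 0, 0]
/-- `e₂ = (0,1,0)`. [folklore] -/
def e2 : Fin 3 → ℤ := ![0, 1, 0]
/-- `e₁ + e₂ = (1,1,0)`. [folklore] -/
def e12 : Fin 3 → ℤ := ![1, 1, 0]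

/-- The Fourier support `S = {e₁, −e₁, e₂, −e₂, e₁+e₂, −(e₁+e₂)}`. [folklore] -/
def S : Finset (Fin 3 → ℤ) := {e1, -e1, e2, -e2, e12, -e12}

/-- The coefficients `ĉ(±e₁) = (0,0,1)`, `ĉ(±e₂) = (1,0,0)`, `ĉ(e₁+e₂) = (0,0,−i)`,
`ĉ(−e₁−e₂) = (0,0,i)`, zero elsewhere. [folklore] -/
def c (k : Fin 3 → ℤ) : EuclideanSpace ℂ (Fin 3) :=
  if k = e1 ∨ k = -e1 then !₂[0, 0, 1]
  else if k = e2 ∨ k = -e2 then !₂[1, 0, 0]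
  else if k = e12 then !₂[0, 0, -I]
  else if k = -e12 then !₂[0, 0, I]
  else 0

/-- The three-wave field `w = Re ∑_{k∈S} e_k ĉ(k) = (2cos 2πx₂, 0, 2cos 2πx₁ + 2sin 2π(x₁+x₂))`.
[folklore] -/
def w : UnitAddTorus (Fin 3) → EuclideanSpace ℝ (Fin 3) := realTrigPoly S c

/-- Distinctness and negation table of the six wavevectors (by `decide`). [folklore] -/
theorem vec_facts :
    e1 ≠ -e1 ∧ e1 ≠ e2 ∧ e1 ≠ -e2 ∧ e1 ≠ e12 ∧ e1 ≠ -e12 ∧ e2 ≠ -e2 ∧ e2 ≠ e12 ∧ e2 ≠ -e12 ∧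
      e12 ≠ -e12 ∧ -e1 ≠ e2 ∧ -e1 ≠ -e2 ∧ -e1 ≠ e12 ∧ -e1 ≠ -e12 ∧ -e2 ≠ e12 ∧ -e2 ≠ -e12 ∧
      (0 : Fin 3 → ℤ) ≠ e1 ∧ (0 : Fin 3 → ℤ) ≠ -e1 ∧ (0 : Fin 3 → ℤ) ≠ e2 ∧
      (0 : Fin 3 → ℤ) ≠ -e2 ∧ (0 : Fin 3 → ℤ) ≠ e12 ∧ (0 : Fin 3 → ℤ) ≠ -e12 := by
  unfold e1 e2 e12
  decide

/-- `S` is symmetric under `k ↦ −k`. [folklore] -/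
theorem neg_mem_S : ∀ k ∈ S, -k ∈ S := by
  intro k hk
  simp only [S, Finset.mem_insert, Finset.mem_singleton] at hk ⊢
  rcases hk with rfl | rfl | rfl | rfl | rfl | rfl <;> simp

/-- `0 ∉ S`. [folklore] -/
theorem zero_not_mem_S : (0 : Fin 3 → ℤ) ∉ S := by
  have h := vec_facts
  simp only [S, Finset.mem_insert, Finset.mem_singleton, not_or]
  exact ⟨h.2.2.2.2.2.2.2.2.2.2.2.2.2.2.2.1, h.2.2.2.2.2.2.2.2.2.2.2.2.2.2.2.2.1,
    h.2.2.2.2.2.2.2.2.2.2.2.2.2.2.2.2.2.1, h.2.2.2.2.2.2.2.2.2.2.2.2.2.2.2.2.2.2.1,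
    h.2.2.2.2.2.2.2.2.2.2.2.2.2.2.2.2.2.2.2.1, h.2.2.2.2.2.2.2.2.2.2.2.2.2.2.2.2.2.2.2.2⟩

/-! ## The coefficient table -/

/-- `ĉ(e₁) = (0,0,1)`. [folklore] -/
theorem c_e1 : c e1 = !₂[0, 0, 1] := by rw [c, if_pos (Or.inl rfl)]
/-- `ĉ(−e₁) = (0,0,1)`. [folklore] -/
theorem c_neg_e1 : c (-e1) = !₂[0, 0, 1] := by rw [c, if_pos (Or.inr rfl)]
/-- `ĉ(e₂) = (1,0,0)`. [folklore] -/
theorem c_e2 : c e2 = !₂[1, 0, 0] := by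
  rw [c, if_neg (by unfold e1 e2; decide), if_pos (Or.inl rfl)]
/-- `ĉ(−e₂) = (1,0,0)`. [folklore] -/
theorem c_neg_e2 : c (-e2) = !₂[1, 0, 0] := by
  rw [c, if_neg (by unfold e1 e2; decide), if_pos (Or.inr rfl)]
/-- `ĉ(e₁+e₂) = (0,0,−i)`. [folklore] -/
theorem c_e12 : c e12 = !₂[0, 0, -I] := by
  rw [c, if_neg (by unfold e1 e12; decide), if_neg (by unfold e2 e12; decide), if_pos rfl]
/-- `ĉ(−e₁−e₂) = (0,0,i)`. [folklore] -/
theorem c_neg_e12 : c (-e12) = !₂[0, 0, I] := by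
  rw [c, if_neg (by unfold e1 e12; decide), if_neg (by unfold e2 e12; decide),
    if_neg (by unfold e12; decide), if_pos rfl]

/-- Off the support the coefficients vanish. [folklore] -/
theorem c_of_not_mem {k : Fin 3 → ℤ} (hk : k ∉ S) : c k = 0 := by
  simp only [S, Finset.mem_insert, Finset.mem_singleton, not_or] at hk
  obtain ⟨h1, h2, h3, h4, h5, h6⟩ := hk
  rw [c, if_neg (not_or.mpr ⟨h1, h2⟩), if_neg (not_or.mpr ⟨h3, h4⟩), if_neg h5, if_neg h6]

/-- Membership in `S`, spelled out. [folklore] -/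
theorem mem_S {k : Fin 3 → ℤ} :
    k ∈ S ↔ k = e1 ∨ k = -e1 ∨ k = e2 ∨ k = -e2 ∨ k = e12 ∨ k = -e12 := by
  simp only [S, Finset.mem_insert, Finset.mem_singleton]

/-- Conjugation table of the coefficient vectors. [folklore] -/
theorem conjVec_table :
    EuclideanSpace.conjVec (!₂[0, 0, 1] : EuclideanSpace ℂ (Fin 3)) = !₂[0, 0, 1] ∧
    EuclideanSpace.conjVec (!₂[1, 0, 0] : EuclideanSpace ℂ (Fin 3)) = !₂[1, 0, 0] ∧
    EuclideanSpace.conjVec (!₂[0, 0, -I] : EuclideanSpace ℂ (Fin 3)) = !₂[0, 0, I] ∧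
    EuclideanSpace.conjVec (!₂[0, 0, I] : EuclideanSpace ℂ (Fin 3)) = !₂[0, 0, -I] := by
  refine ⟨?_, ?_, ?_, ?_⟩ <;> ext i <;> fin_cases i <;>
    simp [EuclideanSpace.conjVec_apply]

/-- **The coefficients are conjugate-symmetric** (`ĉ(−k) = conj ĉ(k)`): the field is real.
[folklore] -/
theorem isConjSymm_c : IsConjSymm c := by
  intro k
  obtain ⟨t1, t2, t3, t4⟩ := conjVec_table
  by_cases hk : k ∈ S
  · rcases mem_S.mp hk with rfl | rfl | rfl | rfl | rfl | rfl
    · rw [c_neg_e1, c_e1, t1]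
    · rw [neg_neg, c_e1, c_neg_e1, t1]
    · rw [c_neg_e2, c_e2, t2]
    · rw [neg_neg, c_e2, c_neg_e2, t2]
    · rw [c_neg_e12, c_e12, t3]
    · rw [neg_neg, c_e12, c_neg_e12, t4]
  · have hnk : -k ∉ S := fun h => hk (by simpa using neg_mem_S (-k) h)
    rw [c_of_not_mem hk, c_of_not_mem hnk, EuclideanSpace.conjVec_zero]

/-- **The coefficients are transversal** (`k · ĉ(k) = 0`): the field is divergence free.
[folklore] -/
theorem isTransversal_c : IsTransversal S c := by
  intro k hk
  rcases mem_S.mp hk with rfl | rfl | rfl | rfl | rfl | rfl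
  · rw [c_e1]; simp [e1, Fin.sum_univ_three]
  · rw [c_neg_e1]; simp [e1, Fin.sum_univ_three]
  · rw [c_e2]; simp [e2, Fin.sum_univ_three]
  · rw [c_neg_e2]; simp [e2, Fin.sum_univ_three]
  · rw [c_e12]; simp [e12, Fin.sum_univ_three]
  · rw [c_neg_e12]; simp [e12, Fin.sum_univ_three]

/-! ## The field: smooth, divergence free, mean zero -/

/-- `w` is smooth. [folklore] -/
theorem isSmooth_w : IsSmooth w := isSmooth_realTrigPoly S c

/-- `w` is divergence free. [folklore] -/
theorem isDivFree_w : IsDivFree w := isDivFree_realTrigPoly isTransversal_c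

/-- `w` has zero mean (`0 ∉ S`). [folklore] -/
theorem hasZeroMean_w : HasZeroMean w := hasZeroMean_realTrigPoly_of_zero_not_mem zero_not_mem_S c

/-! ## The enstrophy production as a finite Fourier sum -/

/-- Laplacian coefficients `−4π²|k|² ĉ(k)`. [folklore] -/
def cΔ (k : Fin 3 → ℤ) : EuclideanSpace ℂ (Fin 3) :=
  -(((4 * Real.pi ^ 2 * freqNormSq k : ℝ) : ℂ) • c k)

/-- `Δw = Re ∑ e_k (−4π²|k|² ĉ(k))`. [folklore] -/
theorem laplacian_w (x : UnitAddTorus (Fin 3)) : Torus.laplacian w x = realTrigPoly S cΔ x :=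
  laplacian_realTrigPoly S c x

/-- The Laplacian coefficients are conjugate-symmetric. [folklore] -/
theorem isConjSymm_cΔ : IsConjSymm cΔ := by
  intro k
  simp only [cΔ]
  rw [isConjSymm_c k, freqNormSq_neg, EuclideanSpace.conjVec_neg, EuclideanSpace.conjVec_smul,
    Complex.conj_ofReal]

/-- **The enstrophy production of `w` as a finite sum over the support**:
`∫⟪(w·∇)w, Δw⟫ = ∑_{k∈S} Re ⟪N̂(k), −4π²|k|² ĉ(k)⟫_ℂ` with `N̂ = convectionCoeff S ĉ ĉ` the
Fourier coefficients of `(w·∇)w` (`mFourierCoeff_convect_realTrigPoly`) — Parseval against the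
trigonometric polynomial `Δw` (`integral_inner_realTrigPoly_right`). [folklore] -/
theorem production_eq_sum :
    ∫ x, inner ℝ (Torus.convect w w x) (Torus.laplacian w x) =
      ∑ k ∈ S, (inner ℂ (Torus.convectionCoeff S c c k) (cΔ k)).re := by
  simp_rw [laplacian_w]
  rw [integral_inner_realTrigPoly_right neg_mem_S isConjSymm_cΔ
    ((isSmooth_w.convect isSmooth_w).memLp 2)]
  refine Finset.sum_congr rfl fun k _ => ?_
  rw [show w = realTrigPoly S c from rfl,
    Torus.mFourierCoeff_convect_realTrigPoly neg_mem_S isConjSymm_c isConjSymm_c k]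

/-! ## Evaluation of the finite sum -/

/-- Sums over `S`, unrolled. [folklore] -/
theorem sum_S {M : Type*} [AddCommMonoid M] (f : (Fin 3 → ℤ) → M) :
    ∑ k ∈ S, f k = f e1 + f (-e1) + f e2 + f (-e2) + f e12 + f (-e12) := by
  simp only [S]
  rw [Finset.sum_insert, Finset.sum_insert, Finset.sum_insert, Finset.sum_insert,
    Finset.sum_insert, Finset.sum_singleton]
  · simp only [add_assoc]
  all_goals
    simp only [Finset.mem_insert, Finset.mem_singleton, not_or, e1, e2, e12]
    decide

/-- The convection coefficient at `e₁`: `N̂(e₁) = (0, 0, 2π)`. [folklore] -/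
theorem convectionCoeff_e1 : Torus.convectionCoeff S c c e1 = !₂[0, 0, (2 * Real.pi : ℂ)] := by
  rw [Torus.convectionCoeff, sum_S]
  simp only [sum_S, c_e1, c_neg_e1, c_e2, c_neg_e2, c_e12, c_neg_e12]
  unfold e1 e2 e12
  simp +decide only [ite_true, ite_false]
  ext i; fin_cases i
  · simp [Fin.sum_univ_three]
  · simp [Fin.sum_univ_three]
  · simp [Fin.sum_univ_three]; ring_nf; simp [Complex.I_sq]

/-- `N̂(−e₁) = (0, 0, 2π)`. [folklore] -/
theorem convectionCoeff_neg_e1 :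
    Torus.convectionCoeff S c c (-e1) = !₂[0, 0, (2 * Real.pi : ℂ)] := by
  rw [Torus.convectionCoeff, sum_S]
  simp only [sum_S, c_e1, c_neg_e1, c_e2, c_neg_e2, c_e12, c_neg_e12]
  unfold e1 e2 e12
  simp +decide only [ite_true, ite_false]
  ext i; fin_cases i
  · simp [Fin.sum_univ_three]
  · simp [Fin.sum_univ_three]
  · simp [Fin.sum_univ_three]; ring_nf; simp [Complex.I_sq]

/-- `N̂(e₂) = 0`. [folklore] -/
theorem convectionCoeff_e2 : Torus.convectionCoeff S c c e2 = 0 := by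
  rw [Torus.convectionCoeff, sum_S]
  simp only [sum_S, c_e1, c_neg_e1, c_e2, c_neg_e2, c_e12, c_neg_e12]
  unfold e1 e2 e12
  simp +decide only [ite_true, ite_false]
  ext i; fin_cases i <;> simp [Fin.sum_univ_three]

/-- `N̂(−e₂) = 0`. [folklore] -/
theorem convectionCoeff_neg_e2 : Torus.convectionCoeff S c c (-e2) = 0 := by
  rw [Torus.convectionCoeff, sum_S]
  simp only [sum_S, c_e1, c_neg_e1, c_e2, c_neg_e2, c_e12, c_neg_e12]
  unfold e1 e2 e12
  simp +decide only [ite_true, ite_false]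
  ext i; fin_cases i <;> simp [Fin.sum_univ_three]

/-- `N̂(e₁+e₂) = (0, 0, 2πi)`. [folklore] -/
theorem convectionCoeff_e12 :
    Torus.convectionCoeff S c c e12 = !₂[0, 0, (2 * Real.pi : ℂ) * I] := by
  rw [Torus.convectionCoeff, sum_S]
  simp only [sum_S, c_e1, c_neg_e1, c_e2, c_neg_e2, c_e12, c_neg_e12]
  unfold e1 e2 e12
  simp +decide only [ite_true, ite_false]
  ext i; fin_cases i <;> simp [Fin.sum_univ_three]

/-- `N̂(−e₁−e₂) = (0, 0, −2πi)`. [folklore] -/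
theorem convectionCoeff_neg_e12 :
    Torus.convectionCoeff S c c (-e12) = !₂[0, 0, -((2 * Real.pi : ℂ) * I)] := by
  rw [Torus.convectionCoeff, sum_S]
  simp only [sum_S, c_e1, c_neg_e1, c_e2, c_neg_e2, c_e12, c_neg_e12]
  unfold e1 e2 e12
  simp +decide only [ite_true, ite_false]
  ext i; fin_cases i <;> simp [Fin.sum_univ_three]

/-- `|e₁|² = |e₂|² = 1`, `|e₁+e₂|² = 2`. [folklore] -/
theorem freqNormSq_table :
    freqNormSq e1 = 1 ∧ freqNormSq (-e1) = 1 ∧ freqNormSq e2 = 1 ∧ freqNormSq (-e2) = 1 ∧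
      freqNormSq e12 = 2 ∧ freqNormSq (-e12) = 2 := by
  refine ⟨?_, ?_, ?_, ?_, ?_, ?_⟩ <;>
    simp [freqNormSq, e1, e2, e12, Fin.sum_univ_three] <;> norm_num

/-- **The enstrophy production of the three-wave field is `16π³`** (`= (2π)³ · 2`, the Galerkin
value `T_Z = 2` of `FluidComputer/EnstrophyProduction` in unit-torus units). [folklore] -/
theorem production_w :
    ∫ x, inner ℝ (Torus.convect w w x) (Torus.laplacian w x) = 16 * Real.pi ^ 3 := by
  obtain ⟨h1, h1', h2, h2', h12, h12'⟩ := freqNormSq_table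
  rw [production_eq_sum, sum_S, convectionCoeff_e1, convectionCoeff_neg_e1, convectionCoeff_e2,
    convectionCoeff_neg_e2, convectionCoeff_e12, convectionCoeff_neg_e12]
  simp only [cΔ, c_e1, c_neg_e1, c_e2, c_neg_e2, c_e12, c_neg_e12, h1, h1', h2, h2', h12, h12']
  simp [PiLp.inner_apply, Fin.sum_univ_three, Complex.mul_re, Complex.mul_im, -Complex.ofReal_pow]
  ring

/-- In particular the production is non-zero. [folklore] -/
theorem production_w_ne_zero :
    ∫ x, inner ℝ (Torus.convect w w x) (Torus.laplacian w x) ≠ 0 := by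
  rw [production_w]; positivity

end ThreeWaveTorus

/-! ## The no-go entry -/

open ThreeWaveTorus in
/-- The enstrophy production functional of `RateBudgets.lean` at the three-wave field is `16π³`.
[folklore] -/
theorem enstrophyProduction_threeWave : enstrophyProduction w = 16 * Real.pi ^ 3 := production_w

open ThreeWaveTorus in
/-- **NO-GO (census row ℰ / monotone): the enstrophy is not non-increasing along every zero-mean
classical solution of the unforced Navier–Stokes equations on the unit 3-torus.** The rate budget
`IsRateBudget ℰ 0` fails: by `not_isRateBudget_torusEnstrophy_zero_of_witness` (dynamic reduction
+ parity, `RateBudgets.lean`) it would force the enstrophy production to vanish at every smooth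
divergence-free zero-mean field, and the three-wave field `w` has production `16π³ ≠ 0`.
Search for candidate a priori estimates; no regularity claim. [folklore] -/
theorem not_isRateBudget_torusEnstrophy_zero :
    ¬ IsRateBudget (d := Fin 3) torusEnstrophy (fun _ _ => 0) :=
  not_isRateBudget_torusEnstrophy_zero_of_witness (Fintype.card_fin 3) isSmooth_w isDivFree_w
    hasZeroMean_w (by rw [enstrophyProduction_threeWave]; positivity)

end Summit.NavierStokesRegularity.FunctionalMining

end
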